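import Summits.CriticalPhenomena.PercolationContinuityZ3.Theorems.PercNearOneGluingNoHeavyLowerTailSahiOneStepProfileGridOrStepS1
import HarnessLib

/-!
# THE OR-CYLINDER STEP for `(2′)` — part 2/3: the fibre pieces `m_x ≥ 0`, `n_y ≥ 0`

Prover prim-ineq-prove-3 gen 45 (`--supports stmt-CriticalPhenomena-4575`; memo
`run/shared/lean/prim/prim-ineq-prove-3/PROOF-G45-CHAIN-RULE.md` §5).  Uses `…ProfileGridOrStepPrelim` (two-piece identity
`orStep_arith`, abstract fibre lemmas `orStep_T_of_S1`, `orStep_M1_fibre`, `orStep_M2_fibre`), `…ProfileGridOrStepFibre` (point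
restriction, `ball_mono_fibre`) and `…ProfileGridOrStepAtoms` (`fibre_factor`, `fibre_monA`, `fibre_monZ`).

**`gridK_orStep`.**  `φ_j` `PF₂` weights on `{0,…,N}` (not normalised), `Φ = Π φ_j`, slot `{Σ_j v_j ≥ t}`; `i` a coordinate, `c` a cut,
`C` an event NOT depending on `v_i`; `u` a numerator with `0 ≤ u ≤ Φ` and the one-coordinate cross inequalities.  HYPOTHESES, in the
homogeneous cubic form `K̃` of `…ProfileGridChainRule`: (H0) `K̃ ≥ 0` for the LOW piece (`φ_i` restricted to `{n < c}`, numerator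
`u·1[v_i < c]`) against `C` at slot `t`; (H1) `K̃ ≥ 0` for every POINT piece `v_i = y`, `c ≤ y ≤ N` (numerator `u·1[v_i = y]`) against `C`
at every shifted slot `t + y − x`, `x < c`.  CONCLUSION: `K̃(Φ, u; {c ≤ v_i} ∪ C) ≥ 0` at slot `t`.
THIS FILE: `orStep_mx` and `orStep_ny`.
PROOF = memo §5: the eleven atoms of the two pieces, `M̃₁ = Σ_{x<c} m_x` with `m_x ≥ 0` (`orStep_M1_fibre`, fed by `(S1′)` = (H1) in complement
form transported to the fibre `x`, ball monotonicity and the two chain monotonicities), `M̃₂' = Σ_{y≥c} n_y` with `n_y ≥ 0`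
(`orStep_M2_fibre`), and `orStep_arith`.  No definitions, no sorries.
-/

noncomputable section

namespace Summit.CriticalPhenomena.PercolationContinuityZ3.Theorems

namespace SahiOneStep

namespace ProfileGrid

open Finset Function
open Literature.Probability.Distributions (IsLogConcaveSeq piWeight blockSum)
open scoped Classical

variable {κ : Type*} [Fintype κ] [DecidableEq κ] {N : ℕ}
/-! ## `M̃₁ ≥ 0`, one low fibre at a time -/

/-- **`m_x ≥ 0`** (memo (5.4)): for a low value `x < c`, with `Z₁, L₁, A₁, Q₁` the high-piece masses (`c ≤ v_i`) and
`Uch_x, Wcl_x, Wc_x` the fibre-`x` masses of `H ∩ Cᶜ` (under `u`), `Cᶜ ∩ L`, `Cᶜ` (under `Φ`):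
`Z₁·L₁·Uch_x + Z₁·Q₁·Wcl_x ≤ L₁·A₁·Wc_x`. [this work] -/
theorem orStep_mx (φ : κ → ℕ → ℝ) (hφ : ∀ j, IsLogConcaveSeq (φ j)) (i : κ) (c t : ℕ)
    (PC : (κ → Fin (N + 1)) → Prop) [DecidablePred PC] (hPCi : ∀ v k, PC (update v i k) ↔ PC v)
    {u a : (κ → Fin (N + 1)) → ℝ} (hu0 : ∀ v, 0 ≤ u v) (huΦ : ∀ v, u v ≤ piWeight N φ v) (ha : Monotone a)
    (hua : ∀ v, u v = a v * piWeight N φ v)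
    (hmono : ∀ v j (x x' : Fin (N + 1)), x ≤ x' → u (update v j x) * φ j x' ≤ u (update v j x') * φ j x)
    (x : Fin (N + 1)) (hxc : (x : ℕ) < c)
    (H1x : ∀ y : ℕ, c ≤ y → y ≤ N →
      0 ≤ (∑ v : κ → Fin (N + 1), piWeight N (update φ i (fun n => if n = y then φ i n else 0)) v) *
          (∑ v : κ → Fin (N + 1), if ¬ t + y - (x : ℕ) ≤ blockSum univ v then
            piWeight N (update φ i (fun n => if n = y then φ i n else 0)) v else 0) *
          (∑ v : κ → Fin (N + 1), if t + y - (x : ℕ) ≤ blockSum univ v ∧ PC v then (if (v i : ℕ) = y then u v else 0) else 0)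
        + (∑ v : κ → Fin (N + 1), piWeight N (update φ i (fun n => if n = y then φ i n else 0)) v) *
          (∑ v : κ → Fin (N + 1), if ¬ t + y - (x : ℕ) ≤ blockSum univ v then (if (v i : ℕ) = y then u v else 0) else 0) *
          (∑ v : κ → Fin (N + 1), if PC v ∧ ¬ t + y - (x : ℕ) ≤ blockSum univ v then
            piWeight N (update φ i (fun n => if n = y then φ i n else 0)) v else 0)
        - (∑ v : κ → Fin (N + 1), if ¬ t + y - (x : ℕ) ≤ blockSum univ v then
            piWeight N (update φ i (fun n => if n = y then φ i n else 0)) v else 0) *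
          (∑ v : κ → Fin (N + 1), (if (v i : ℕ) = y then u v else 0)) *
          (∑ v : κ → Fin (N + 1), if PC v then piWeight N (update φ i (fun n => if n = y then φ i n else 0)) v else 0)) :
    (∑ v : κ → Fin (N + 1), if c ≤ (v i : ℕ) then piWeight N φ v else 0) *
        (∑ v : κ → Fin (N + 1), if c ≤ (v i : ℕ) ∧ ¬ t ≤ blockSum univ v then piWeight N φ v else 0) *
        (∑ v : κ → Fin (N + 1), if (v i : ℕ) = (x : ℕ) ∧ (t ≤ blockSum univ v ∧ ¬ PC v) then u v else 0)
      + (∑ v : κ → Fin (N + 1), if c ≤ (v i : ℕ) then piWeight N φ v else 0) *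
        (∑ v : κ → Fin (N + 1), if c ≤ (v i : ℕ) ∧ ¬ t ≤ blockSum univ v then u v else 0) *
        (∑ v : κ → Fin (N + 1), if (v i : ℕ) = (x : ℕ) ∧ (¬ PC v ∧ ¬ t ≤ blockSum univ v) then piWeight N φ v else 0) ≤
      (∑ v : κ → Fin (N + 1), if c ≤ (v i : ℕ) ∧ ¬ t ≤ blockSum univ v then piWeight N φ v else 0) *
        (∑ v : κ → Fin (N + 1), if c ≤ (v i : ℕ) then u v else 0) *
        (∑ v : κ → Fin (N + 1), if (v i : ℕ) = (x : ℕ) ∧ ¬ PC v then piWeight N φ v else 0) := by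
  have hφ0 : ∀ j n, 0 ≤ φ j n := fun j => (hφ j).1
  have hw0 : ∀ v, 0 ≤ piWeight N φ v := fun v => piWeight_nonneg hφ0 v
  set hiS : Finset ℕ := (range (N + 1)).filter (fun y => c ≤ y) with hhiS
  have hiS_mem : ∀ {y}, y ∈ hiS → c ≤ y ∧ y ≤ N := fun hy => by
    rw [hhiS, mem_filter, mem_range] at hy; exact ⟨hy.2, Nat.lt_succ_iff.1 hy.1⟩
  -- fibre functions
  set zF : ℕ → ℝ := fun y => ∑ v : κ → Fin (N + 1), if (v i : ℕ) = y then piWeight N φ v else 0 with hzF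
  set lF : ℕ → ℝ := fun y => ∑ v : κ → Fin (N + 1), if (v i : ℕ) = y ∧ ¬ t ≤ blockSum univ v then piWeight N φ v else 0 with hlF
  set aF : ℕ → ℝ := fun y => ∑ v : κ → Fin (N + 1), if (v i : ℕ) = y then u v else 0 with haF
  set qF : ℕ → ℝ := fun y => ∑ v : κ → Fin (N + 1), if (v i : ℕ) = y ∧ ¬ t ≤ blockSum univ v then u v else 0 with hqF
  set kF : ℕ → ℝ := fun y => ∑ v : κ → Fin (N + 1), if (v i : ℕ) = y ∧ ¬ t ≤ blockSum univ (update v i x) then u v else 0 with hkF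
  set mF : ℕ → ℝ := fun y => ∑ v : κ → Fin (N + 1), if (v i : ℕ) = y ∧ ¬ t ≤ blockSum univ (update v i x) then piWeight N φ v else 0
    with hmF
  -- high-piece atoms as fibre sums
  have dZ : (∑ v : κ → Fin (N + 1), if c ≤ (v i : ℕ) then piWeight N φ v else 0) = ∑ y ∈ hiS, zF y :=
    sum_fibre_filter i (fun y => c ≤ y) _
  have dA : (∑ v : κ → Fin (N + 1), if c ≤ (v i : ℕ) then u v else 0) = ∑ y ∈ hiS, aF y :=
    sum_fibre_filter i (fun y => c ≤ y) _
  have dL : (∑ v : κ → Fin (N + 1), if c ≤ (v i : ℕ) ∧ ¬ t ≤ blockSum univ v then piWeight N φ v else 0) = ∑ y ∈ hiS, lF y := by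
    have e : (∑ v : κ → Fin (N + 1), if c ≤ (v i : ℕ) ∧ ¬ t ≤ blockSum univ v then piWeight N φ v else 0) =
        ∑ v : κ → Fin (N + 1), if c ≤ (v i : ℕ) then (if ¬ t ≤ blockSum univ v then piWeight N φ v else 0) else 0 :=
      sum_congr rfl fun v _ => by by_cases h1 : c ≤ (v i : ℕ) <;> by_cases h2 : t ≤ blockSum univ v <;> simp [h1, h2]
    rw [e, sum_fibre_filter i (fun y => c ≤ y)]
    refine sum_congr rfl fun y _ => sum_congr rfl fun v _ => ?_
    by_cases h1 : (v i : ℕ) = y <;> by_cases h2 : t ≤ blockSum univ v <;> simp [h1, h2]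
  have dQ : (∑ v : κ → Fin (N + 1), if c ≤ (v i : ℕ) ∧ ¬ t ≤ blockSum univ v then u v else 0) = ∑ y ∈ hiS, qF y := by
    have e : (∑ v : κ → Fin (N + 1), if c ≤ (v i : ℕ) ∧ ¬ t ≤ blockSum univ v then u v else 0) =
        ∑ v : κ → Fin (N + 1), if c ≤ (v i : ℕ) then (if ¬ t ≤ blockSum univ v then u v else 0) else 0 :=
      sum_congr rfl fun v _ => by by_cases h1 : c ≤ (v i : ℕ) <;> by_cases h2 : t ≤ blockSum univ v <;> simp [h1, h2]
    rw [e, sum_fibre_filter i (fun y => c ≤ y)]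
    refine sum_congr rfl fun y _ => sum_congr rfl fun v _ => ?_
    by_cases h1 : (v i : ℕ) = y <;> by_cases h2 : t ≤ blockSum univ v <;> simp [h1, h2]
  rw [dZ, dA, dL, dQ]
  -- the rest-masses of the slot-`x` ball and of everything, on the fibre `0`
  set RZ : ℝ := ∑ v : κ → Fin (N + 1), if (v i : ℕ) = 0 then (∏ j ∈ univ.erase i, φ j (v j)) else 0 with hRZ
  set RM : ℝ := ∑ v : κ → Fin (N + 1), if (v i : ℕ) = 0 then
      (∏ j ∈ univ.erase i, φ j (v j)) * (if ¬ t ≤ blockSum univ (update v i x) then (1 : ℝ) else 0) else 0 with hRM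
  have hzF_fac : ∀ {y}, y ≤ N → zF y = φ i y * RZ := by
    intro y hyN
    have h := fibre_factor φ i (fun _ => (1 : ℝ)) hyN
    have e : (∑ v : κ → Fin (N + 1), if (v i : ℕ) = y then piWeight N φ v * (fun _ => (1 : ℝ)) v else 0) = zF y :=
      sum_congr rfl fun v _ => by simp only [mul_one]
    rw [e] at h; rw [h]
    congr 1
    exact sum_congr rfl fun v _ => by simp only [mul_one]
  have hmF_fac : ∀ {y}, y ≤ N → mF y = φ i y * RM := by
    intro y hyN
    have h := fibre_factor φ i (fun v => if ¬ t ≤ blockSum univ (update v i x) then (1 : ℝ) else 0) hyN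
    have e : (∑ v : κ → Fin (N + 1), if (v i : ℕ) = y then
        piWeight N φ v * (fun v => if ¬ t ≤ blockSum univ (update v i x) then (1 : ℝ) else 0) v else 0) = mF y :=
      sum_congr rfl fun v _ => by
        by_cases h1 : (v i : ℕ) = y <;> by_cases h2 : t ≤ blockSum univ (update v i x) <;> simp [h1, h2]
    rw [e] at h; rw [h]
    congr 1
    exact sum_congr rfl fun v _ => by simp only [update_idem]
  have hRZ0 : 0 ≤ RZ := sum_nonneg fun v _ => by split_ifs <;> [exact prod_erase_nonneg hφ0 i v; exact le_rfl]
  have hRM0 : 0 ≤ RM := sum_nonneg fun v _ => by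
    split_ifs <;> first | exact le_rfl | exact mul_nonneg (prod_erase_nonneg hφ0 i v) (by norm_num)
  -- the common ratio
  set ℓx : ℝ := if RZ = 0 then 0 else RM / RZ with hℓx
  have hℓx0 : 0 ≤ ℓx := by rw [hℓx]; split_ifs <;> [exact le_rfl; exact div_nonneg hRM0 hRZ0]
  have hmz : ∀ y ∈ hiS, mF y = ℓx * zF y := by
    intro y hy
    have hyN := (hiS_mem hy).2
    rw [hmF_fac hyN, hzF_fac hyN, hℓx]
    split_ifs with h0
    · -- `RZ = 0`: then `RM ≤ RZ = 0`
      have hRM_le : RM ≤ RZ := sum_le_sum fun v _ => by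
        by_cases hv : (v i : ℕ) = 0
        · rw [if_pos hv, if_pos hv]
          have : (if ¬ t ≤ blockSum univ (update v i x) then (1 : ℝ) else 0) ≤ 1 := by split_ifs <;> norm_num
          nlinarith [prod_erase_nonneg hφ0 i v]
        · rw [if_neg hv, if_neg hv]
      have : RM = 0 := le_antisymm (h0 ▸ hRM_le) hRM0
      rw [this]; ring
    · field_simp
  -- nonnegativity and bounds of the fibre functions
  have hz : ∀ y ∈ hiS, 0 ≤ zF y := fun y _ => sum_ite_nonneg' hw0 _
  have hl : ∀ y ∈ hiS, 0 ≤ lF y := fun y _ => sum_ite_nonneg' hw0 _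
  have hq : ∀ y ∈ hiS, 0 ≤ qF y := fun y _ => sum_ite_nonneg' hu0 _
  have hk : ∀ y ∈ hiS, 0 ≤ kF y := fun y _ => sum_ite_nonneg' hu0 _
  have haz : ∀ y ∈ hiS, aF y ≤ zF y := fun y _ => sum_ite_le_of_le huΦ _
  have hka : ∀ y ∈ hiS, kF y ≤ aF y := fun y _ => sum_ite_le_of_imp hu0 fun v hv => hv.1
  have hql : ∀ y ∈ hiS, qF y ≤ lF y := fun y _ => sum_ite_le_of_le huΦ _
  have hlm : ∀ y ∈ hiS, lF y ≤ mF y := by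
    intro y hy
    refine sum_ite_le_of_imp hw0 fun v hv => ⟨hv.1, fun h2 => hv.2 (h2.trans ?_)⟩
    rw [blockSum_univ_eq_add_erase (update v i x) i, blockSum_univ_eq_add_erase v i, update_self, blockSum_erase_update, hv.1]
    have := (hiS_mem hy).1; omega
  -- (S1'), ball monotonicity, the two chain monotonicities
  have hS1 : ∀ y ∈ hiS, zF y * mF y * (∑ v : κ → Fin (N + 1), if (v i : ℕ) = (x : ℕ) ∧ (t ≤ blockSum univ v ∧ ¬ PC v) then u v else 0)
      + zF y * kF y * (∑ v : κ → Fin (N + 1), if (v i : ℕ) = (x : ℕ) ∧ (¬ PC v ∧ ¬ t ≤ blockSum univ v) then piWeight N φ v else 0) ≤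
      mF y * aF y * (∑ v : κ → Fin (N + 1), if (v i : ℕ) = (x : ℕ) ∧ ¬ PC v then piWeight N φ v else 0) := by
    intro y hy
    obtain ⟨hcy, hyN⟩ := hiS_mem hy
    exact orStep_S1 φ hφ0 i t PC hPCi hu0 hmono x (y := y) (by omega) hyN (H1x y hcy hyN)
  have hBM : ∀ y ∈ hiS, qF y * mF y ≤ kF y * lF y := by
    intro y hy
    obtain ⟨hcy, hyN⟩ := hiS_mem hy
    have h := ball_mono_fibre φ hφ ha hua i y x (by omega) t
    have c1 : ∀ (f : (κ → Fin (N + 1)) → ℝ), (∑ v : κ → Fin (N + 1), if (v i : ℕ) = y ∧ blockSum univ v < t then f v else 0) =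
        ∑ v : κ → Fin (N + 1), if (v i : ℕ) = y ∧ ¬ t ≤ blockSum univ v then f v else 0 :=
      fun f => sum_congr rfl fun v _ => by simp only [← Nat.not_le]
    have c2 : ∀ (f : (κ → Fin (N + 1)) → ℝ),
        (∑ v : κ → Fin (N + 1), if (v i : ℕ) = y ∧ blockSum univ (update v i x) < t then f v else 0) =
        ∑ v : κ → Fin (N + 1), if (v i : ℕ) = y ∧ ¬ t ≤ blockSum univ (update v i x) then f v else 0 :=
      fun f => sum_congr rfl fun v _ => by simp only [← Nat.not_le]
    rw [c1, c1, c2, c2] at h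
    exact h
  have hMonZ : ∀ y ∈ hiS, ∀ y' ∈ hiS, y ≤ y' → lF y' * zF y ≤ lF y * zF y' :=
    fun y _ y' hy' hyy' => fibre_monZ φ hφ0 i t hyy' (hiS_mem hy').2
  have hEx : ∀ (v : κ → Fin (N + 1)) (k : Fin (N + 1)),
      (¬ t ≤ blockSum univ (update (update v i k) i x)) ↔ (¬ t ≤ blockSum univ (update v i x)) := fun v k => by rw [update_idem]
  have hMonK : ∀ y ∈ hiS, ∀ y' ∈ hiS, y ≤ y' → kF y * zF y' ≤ kF y' * zF y :=
    fun y _ y' hy' hyy' => fibre_monA_dec φ hφ0 i hmono (fun v => ¬ t ≤ blockSum univ (update v i x)) hEx hyy' (hiS_mem hy').2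
  have hW' : 0 ≤ ∑ v : κ → Fin (N + 1), if (v i : ℕ) = (x : ℕ) ∧ (¬ PC v ∧ ¬ t ≤ blockSum univ v) then piWeight N φ v else 0 :=
    sum_ite_nonneg' hw0 _
  exact orStep_M1_fibre hiS zF lF aF qF kF mF hℓx0 hW' hz hl hq hk haz hka hql hlm hmz hS1 hBM hMonZ hMonK

/-! ## `M̃₂' ≥ 0`, one high fibre at a time -/

/-- **`n_y ≥ 0`** (memo (5.5)): for a high value `y ≥ c`, with the low-piece masses `Z₀, L₀, G₀, T₀, A₀` and `Uc = u(low ∩ H ∩ Cᶜ)`,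
the `y`-summand of `M̃₂'` is nonnegative. [this work] -/
theorem orStep_ny (φ : κ → ℕ → ℝ) (hφ : ∀ j, IsLogConcaveSeq (φ j)) (i : κ) (c t : ℕ)
    (PC : (κ → Fin (N + 1)) → Prop) [DecidablePred PC] (hPCi : ∀ v k, PC (update v i k) ↔ PC v)
    {u a : (κ → Fin (N + 1)) → ℝ} (hu0 : ∀ v, 0 ≤ u v) (huΦ : ∀ v, u v ≤ piWeight N φ v) (ha : Monotone a)
    (hua : ∀ v, u v = a v * piWeight N φ v)
    (hmono : ∀ v j (x x' : Fin (N + 1)), x ≤ x' → u (update v j x) * φ j x' ≤ u (update v j x') * φ j x)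
    {y : ℕ} (hcy : c ≤ y) (hyN : y ≤ N)
    (H1y : ∀ x : Fin (N + 1), (x : ℕ) < c →
      0 ≤ (∑ v : κ → Fin (N + 1), piWeight N (update φ i (fun n => if n = y then φ i n else 0)) v) *
          (∑ v : κ → Fin (N + 1), if ¬ t + y - (x : ℕ) ≤ blockSum univ v then
            piWeight N (update φ i (fun n => if n = y then φ i n else 0)) v else 0) *
          (∑ v : κ → Fin (N + 1), if t + y - (x : ℕ) ≤ blockSum univ v ∧ PC v then (if (v i : ℕ) = y then u v else 0) else 0)
        + (∑ v : κ → Fin (N + 1), piWeight N (update φ i (fun n => if n = y then φ i n else 0)) v) *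
          (∑ v : κ → Fin (N + 1), if ¬ t + y - (x : ℕ) ≤ blockSum univ v then (if (v i : ℕ) = y then u v else 0) else 0) *
          (∑ v : κ → Fin (N + 1), if PC v ∧ ¬ t + y - (x : ℕ) ≤ blockSum univ v then
            piWeight N (update φ i (fun n => if n = y then φ i n else 0)) v else 0)
        - (∑ v : κ → Fin (N + 1), if ¬ t + y - (x : ℕ) ≤ blockSum univ v then
            piWeight N (update φ i (fun n => if n = y then φ i n else 0)) v else 0) *
          (∑ v : κ → Fin (N + 1), (if (v i : ℕ) = y then u v else 0)) *
          (∑ v : κ → Fin (N + 1), if PC v then piWeight N (update φ i (fun n => if n = y then φ i n else 0)) v else 0)) :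
    0 ≤ (∑ v : κ → Fin (N + 1), if ¬ c ≤ (v i : ℕ) then piWeight N φ v else 0) *
          ((∑ v : κ → Fin (N + 1), if ¬ c ≤ (v i : ℕ) then piWeight N φ v else 0) -
            (∑ v : κ → Fin (N + 1), if ¬ c ≤ (v i : ℕ) ∧ PC v then piWeight N φ v else 0)) *
          (∑ v : κ → Fin (N + 1), if ¬ c ≤ (v i : ℕ) ∧ ¬ t ≤ blockSum univ v then piWeight N φ v else 0) *
          (∑ v : κ → Fin (N + 1), if (v i : ℕ) = y then u v else 0)
        - ((∑ v : κ → Fin (N + 1), if ¬ c ≤ (v i : ℕ) then piWeight N φ v else 0) -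
            (∑ v : κ → Fin (N + 1), if ¬ c ≤ (v i : ℕ) ∧ PC v then piWeight N φ v else 0)) *
          (∑ v : κ → Fin (N + 1), if ¬ c ≤ (v i : ℕ) then u v else 0) *
          ((∑ v : κ → Fin (N + 1), if ¬ c ≤ (v i : ℕ) ∧ ¬ t ≤ blockSum univ v then piWeight N φ v else 0) *
              (∑ v : κ → Fin (N + 1), if (v i : ℕ) = y then piWeight N φ v else 0) -
            (∑ v : κ → Fin (N + 1), if ¬ c ≤ (v i : ℕ) then piWeight N φ v else 0) *
              (∑ v : κ → Fin (N + 1), if (v i : ℕ) = y ∧ ¬ t ≤ blockSum univ v then piWeight N φ v else 0))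
        - (∑ v : κ → Fin (N + 1), if ¬ c ≤ (v i : ℕ) then piWeight N φ v else 0) ^ 2 *
          (∑ v : κ → Fin (N + 1), if ¬ c ≤ (v i : ℕ) ∧ (t ≤ blockSum univ v ∧ ¬ PC v) then u v else 0) *
          (∑ v : κ → Fin (N + 1), if (v i : ℕ) = y ∧ ¬ t ≤ blockSum univ v then piWeight N φ v else 0)
        - (∑ v : κ → Fin (N + 1), if ¬ c ≤ (v i : ℕ) then piWeight N φ v else 0) ^ 2 *
          ((∑ v : κ → Fin (N + 1), if ¬ c ≤ (v i : ℕ) ∧ ¬ t ≤ blockSum univ v then piWeight N φ v else 0) -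
            (∑ v : κ → Fin (N + 1), if ¬ c ≤ (v i : ℕ) ∧ (PC v ∧ ¬ t ≤ blockSum univ v) then piWeight N φ v else 0)) *
          (∑ v : κ → Fin (N + 1), if (v i : ℕ) = y ∧ ¬ t ≤ blockSum univ v then u v else 0) := by
  have hφ0 : ∀ j n, 0 ≤ φ j n := fun j => (hφ j).1
  have hw0 : ∀ v, 0 ≤ piWeight N φ v := fun v => piWeight_nonneg hφ0 v
  set loS : Finset ℕ := (range (N + 1)).filter (fun x => ¬ c ≤ x) with hloS
  have loS_mem : ∀ {x}, x ∈ loS → x < c ∧ x ≤ N := fun hx => by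
    rw [hloS, mem_filter, mem_range] at hx; exact ⟨not_le.1 hx.2, Nat.lt_succ_iff.1 hx.1⟩
  -- fibre-`y` masses
  have hz : 0 ≤ ∑ v : κ → Fin (N + 1), if (v i : ℕ) = y then piWeight N φ v else 0 := sum_ite_nonneg' hw0 _
  have hl : 0 ≤ ∑ v : κ → Fin (N + 1), if (v i : ℕ) = y ∧ ¬ t ≤ blockSum univ v then piWeight N φ v else 0 := sum_ite_nonneg' hw0 _
  have hlz : (∑ v : κ → Fin (N + 1), if (v i : ℕ) = y ∧ ¬ t ≤ blockSum univ v then piWeight N φ v else 0) ≤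
      ∑ v : κ → Fin (N + 1), if (v i : ℕ) = y then piWeight N φ v else 0 := sum_ite_le_of_imp hw0 fun v hv => hv.1
  have haz : (∑ v : κ → Fin (N + 1), if (v i : ℕ) = y then u v else 0) ≤ ∑ v : κ → Fin (N + 1), if (v i : ℕ) = y then piWeight N φ v else 0 :=
    sum_ite_le_of_le huΦ _
  have ha0 : 0 ≤ ∑ v : κ → Fin (N + 1), if (v i : ℕ) = y then u v else 0 := sum_ite_nonneg' hu0 _
  have hql : (∑ v : κ → Fin (N + 1), if (v i : ℕ) = y ∧ ¬ t ≤ blockSum univ v then u v else 0) ≤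
      ∑ v : κ → Fin (N + 1), if (v i : ℕ) = y ∧ ¬ t ≤ blockSum univ v then piWeight N φ v else 0 := sum_ite_le_of_le huΦ _
  have hq : 0 ≤ ∑ v : κ → Fin (N + 1), if (v i : ℕ) = y ∧ ¬ t ≤ blockSum univ v then u v else 0 := sum_ite_nonneg' hu0 _
  have hGZ : (∑ v : κ → Fin (N + 1), if ¬ c ≤ (v i : ℕ) ∧ PC v then piWeight N φ v else 0) ≤
      ∑ v : κ → Fin (N + 1), if ¬ c ≤ (v i : ℕ) then piWeight N φ v else 0 := sum_ite_le_of_imp hw0 fun v hv => hv.1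
  -- low-piece masses as sums over the low fibres
  have dec : ∀ (E : (κ → Fin (N + 1)) → Prop) [DecidablePred E] (f : (κ → Fin (N + 1)) → ℝ),
      (∑ v : κ → Fin (N + 1), if ¬ c ≤ (v i : ℕ) ∧ E v then f v else 0) =
        ∑ x ∈ loS, ∑ v : κ → Fin (N + 1), if (v i : ℕ) = x ∧ E v then f v else 0 := by
    intro E _ f
    have e1 : (∑ v : κ → Fin (N + 1), if ¬ c ≤ (v i : ℕ) ∧ E v then f v else 0) =
        ∑ v : κ → Fin (N + 1), if ¬ c ≤ (v i : ℕ) then (if E v then f v else 0) else 0 :=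
      sum_congr rfl fun v _ => by by_cases h1 : c ≤ (v i : ℕ) <;> by_cases h2 : E v <;> simp [h1, h2]
    rw [e1, sum_fibre_filter i (fun x => ¬ c ≤ x)]
    refine sum_congr rfl fun x _ => sum_congr rfl fun v _ => ?_
    by_cases h1 : (v i : ℕ) = x <;> by_cases h2 : E v <;> simp [h1, h2]
  have dZ0 : (∑ v : κ → Fin (N + 1), if ¬ c ≤ (v i : ℕ) then piWeight N φ v else 0) =
      ∑ x ∈ loS, ∑ v : κ → Fin (N + 1), if (v i : ℕ) = x then piWeight N φ v else 0 := sum_fibre_filter i (fun x => ¬ c ≤ x) _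
  have dA0 : (∑ v : κ → Fin (N + 1), if ¬ c ≤ (v i : ℕ) then u v else 0) =
      ∑ x ∈ loS, ∑ v : κ → Fin (N + 1), if (v i : ℕ) = x then u v else 0 := sum_fibre_filter i (fun x => ¬ c ≤ x) _
  have dL0 := dec (fun v => ¬ t ≤ blockSum univ v) (fun v => piWeight N φ v)
  have dZc : (∑ v : κ → Fin (N + 1), if ¬ c ≤ (v i : ℕ) then piWeight N φ v else 0) -
      (∑ v : κ → Fin (N + 1), if ¬ c ≤ (v i : ℕ) ∧ PC v then piWeight N φ v else 0) =
      ∑ x ∈ loS, ∑ v : κ → Fin (N + 1), if (v i : ℕ) = x ∧ ¬ PC v then piWeight N φ v else 0 := by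
    rw [← dec (fun v => ¬ PC v) (fun v => piWeight N φ v), sub_eq_iff_eq_add, ← sum_add_distrib]
    exact sum_congr rfl fun v _ => by by_cases h1 : c ≤ (v i : ℕ) <;> by_cases h2 : PC v <;> simp [h1, h2]
  have dLc : (∑ v : κ → Fin (N + 1), if ¬ c ≤ (v i : ℕ) ∧ ¬ t ≤ blockSum univ v then piWeight N φ v else 0) -
      (∑ v : κ → Fin (N + 1), if ¬ c ≤ (v i : ℕ) ∧ (PC v ∧ ¬ t ≤ blockSum univ v) then piWeight N φ v else 0) =
      ∑ x ∈ loS, ∑ v : κ → Fin (N + 1), if (v i : ℕ) = x ∧ (¬ PC v ∧ ¬ t ≤ blockSum univ v) then piWeight N φ v else 0 := by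
    rw [← dec (fun v => ¬ PC v ∧ ¬ t ≤ blockSum univ v) (fun v => piWeight N φ v), sub_eq_iff_eq_add, ← sum_add_distrib]
    exact sum_congr rfl fun v _ => by
      by_cases h1 : c ≤ (v i : ℕ) <;> by_cases h2 : PC v <;> by_cases h3 : t ≤ blockSum univ v <;> simp [h1, h2, h3]
  have dUc := dec (fun v => t ≤ blockSum univ v ∧ ¬ PC v) u
  -- (T̄_y): sum over the low fibres of `orStep_T_of_S1`
  have hT : ∀ x ∈ loS,
      (∑ v : κ → Fin (N + 1), if (v i : ℕ) = y then piWeight N φ v else 0) *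
        (∑ v : κ → Fin (N + 1), if (v i : ℕ) = y ∧ ¬ t ≤ blockSum univ v then piWeight N φ v else 0) *
        (∑ v : κ → Fin (N + 1), if (v i : ℕ) = x ∧ (t ≤ blockSum univ v ∧ ¬ PC v) then u v else 0) +
      (∑ v : κ → Fin (N + 1), if (v i : ℕ) = y then piWeight N φ v else 0) *
        (∑ v : κ → Fin (N + 1), if (v i : ℕ) = y ∧ ¬ t ≤ blockSum univ v then u v else 0) *
        (∑ v : κ → Fin (N + 1), if (v i : ℕ) = x ∧ (¬ PC v ∧ ¬ t ≤ blockSum univ v) then piWeight N φ v else 0) ≤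
      (∑ v : κ → Fin (N + 1), if (v i : ℕ) = y ∧ ¬ t ≤ blockSum univ v then piWeight N φ v else 0) *
        (∑ v : κ → Fin (N + 1), if (v i : ℕ) = y then u v else 0) *
        (∑ v : κ → Fin (N + 1), if (v i : ℕ) = x ∧ ¬ PC v then piWeight N φ v else 0) := by
    intro x hx
    obtain ⟨hxc, hxN⟩ := loS_mem hx
    set x' : Fin (N + 1) := ⟨x, Nat.lt_succ_of_le hxN⟩ with hx'
    have hxy : (x' : ℕ) ≤ y := by simp only [hx']; omega
    have hS1 := orStep_S1 φ hφ0 i t PC hPCi hu0 hmono x' (y := y) hxy hyN (H1y x' (by simp only [hx']; exact hxc))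
    have hBM' := ball_mono_fibre φ hφ ha hua i y x' hxy t
    have c1 : ∀ (f : (κ → Fin (N + 1)) → ℝ), (∑ v : κ → Fin (N + 1), if (v i : ℕ) = y ∧ blockSum univ v < t then f v else 0) =
        ∑ v : κ → Fin (N + 1), if (v i : ℕ) = y ∧ ¬ t ≤ blockSum univ v then f v else 0 :=
      fun f => sum_congr rfl fun v _ => by simp only [← Nat.not_le]
    have c2 : ∀ (f : (κ → Fin (N + 1)) → ℝ),
        (∑ v : κ → Fin (N + 1), if (v i : ℕ) = y ∧ blockSum univ (update v i x') < t then f v else 0) =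
        ∑ v : κ → Fin (N + 1), if (v i : ℕ) = y ∧ ¬ t ≤ blockSum univ (update v i x') then f v else 0 :=
      fun f => sum_congr rfl fun v _ => by simp only [← Nat.not_le]
    rw [c1, c1, c2, c2] at hBM'
    have hlm : (∑ v : κ → Fin (N + 1), if (v i : ℕ) = y ∧ ¬ t ≤ blockSum univ v then piWeight N φ v else 0) ≤
        ∑ v : κ → Fin (N + 1), if (v i : ℕ) = y ∧ ¬ t ≤ blockSum univ (update v i x') then piWeight N φ v else 0 := by
      refine sum_ite_le_of_imp hw0 fun v hv => ⟨hv.1, fun h2 => hv.2 (h2.trans ?_)⟩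
      rw [blockSum_univ_eq_add_erase (update v i x') i, blockSum_univ_eq_add_erase v i, update_self, blockSum_erase_update, hv.1]
      simp only [hx']; omega
    have hW' : 0 ≤ ∑ v : κ → Fin (N + 1), if (v i : ℕ) = x ∧ (¬ PC v ∧ ¬ t ≤ blockSum univ v) then piWeight N φ v else 0 :=
      sum_ite_nonneg' hw0 _
    have := orStep_T_of_S1 hz hl hlm hql hq hW' hS1 hBM'
    simpa only [hx'] using this
  have hTsum := sum_le_sum hT
  rw [sum_add_distrib, ← mul_sum, ← mul_sum, ← mul_sum, ← dZc, ← dLc, ← dUc] at hTsum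
  -- the two monotonicities, summed over the low fibres
  have hMonL : (∑ v : κ → Fin (N + 1), if ¬ c ≤ (v i : ℕ) then piWeight N φ v else 0) *
        (∑ v : κ → Fin (N + 1), if (v i : ℕ) = y ∧ ¬ t ≤ blockSum univ v then piWeight N φ v else 0) ≤
      (∑ v : κ → Fin (N + 1), if ¬ c ≤ (v i : ℕ) ∧ ¬ t ≤ blockSum univ v then piWeight N φ v else 0) *
        (∑ v : κ → Fin (N + 1), if (v i : ℕ) = y then piWeight N φ v else 0) := by
    rw [dZ0, dL0, sum_mul, sum_mul]
    refine sum_le_sum fun x hx => ?_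
    obtain ⟨hxc, _⟩ := loS_mem hx
    have h := fibre_monZ φ hφ0 i t (y := x) (y' := y) (by omega) hyN
    linarith [h]
  have hMonA : (∑ v : κ → Fin (N + 1), if ¬ c ≤ (v i : ℕ) then u v else 0) *
        (∑ v : κ → Fin (N + 1), if (v i : ℕ) = y then piWeight N φ v else 0) ≤
      (∑ v : κ → Fin (N + 1), if ¬ c ≤ (v i : ℕ) then piWeight N φ v else 0) *
        (∑ v : κ → Fin (N + 1), if (v i : ℕ) = y then u v else 0) := by
    rw [dZ0, dA0, sum_mul, sum_mul]
    refine sum_le_sum fun x hx => ?_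
    obtain ⟨hxc, _⟩ := loS_mem hx
    have h := fibre_monA_dec φ hφ0 i hmono (fun _ => True) (fun _ _ => Iff.rfl) (y := x) (y' := y) (by omega) hyN
    have e : ∀ (z : ℕ), (∑ v : κ → Fin (N + 1), if (v i : ℕ) = z ∧ True then u v else 0) = ∑ v : κ → Fin (N + 1), if (v i : ℕ) = z then u v else 0 :=
      fun z => sum_congr rfl fun v _ => by simp only [and_true]
    rw [e, e] at h
    linarith [h]
  exact orStep_M2_fibre hz hl hlz haz ha0 hql hq hGZ hTsum hMonL hMonA

end ProfileGrid

end SahiOneStep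

end Summit.CriticalPhenomena.PercolationContinuityZ3.Theorems
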